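import Summits.NavierStokesRegularity.FunctionalMining.CrossedShearField
import Summits.NavierStokesRegularity.FunctionalMining.PressureMomentRate
import Summits.NavierStokesRegularity.FunctionalMining.HeatSieve
import Literature.Analysis.FunctionSpaces.TorusInvLaplacianGradientLp
import HarnessLib

/-!
# FunctionalMining — kernel no-go: the pressure-moment row `EP.p.q=2|T_LD|G1` is FALSE for every κ (W11)

Search for candidate a priori estimates; no regularity claim. Cell `pub-nsfunc`, prove seat
(gen 10). SIEVELD §2 (no-go seat, Proposition/Corollary W11) in the kernel for the core `∫p²`:
for the reciprocal crossed shear `u_β = (e^{β cos 2πz} sin 2πy, e^{−β cos 2πz} sin 2πx, 0)` on the unit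
torus,

* the zero-mean pressure is `π_{u_β} = cos 2πx · cos 2πy` (`pressureOf_csField`: `s_{u_β} =
  ∑∂ᵢuⱼ∂ⱼuᵢ = 8π² cos 2πx cos 2πy = −Δ(cos 2πx cos 2πy)`, and `Δ⁻¹Δh = h` for zero-mean `h`);
* the viscous (heat-flow) rate of `∫π²` (`pressureSqViscousRate`, file `PressureMomentRate`) is
  `V₂(u_β) = 2π²(β² − 2)` (`pressureSqViscousRate_csField`: `Δu_β` is the crossed shear with profiles
  `A″ − 4π²A`, the source is `−8π² h_β(z) cos 2πx cos 2πy`, self-adjointness of `Δ⁻¹`,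
  `Δ⁻¹(cos cos) = −cos cos/(8π²)`, Fubini and `∫h_β = 4π²(β² − 2)`);
* hence for `β = 2` the pressure moment GROWS under pure diffusion (`V₂ = 4π² > 0`), and the heat
  sieve (`not_saturatingLaw_of_viscousRate_pos`, Theorem H) kills the saturating law
  `dF/dt ≤ κν^{−γ}(2ℰ)F^{1+1/σ}` for `F = ∫π²`, EVERY `κ`, every `σ` and every `γ ≥ 0` — in
  particular the K0 row `EP.p.q=2|T_LD|G1` (`σ = 1`, `γ = 5`): `not_saturatingLaw_pressureMoment_two`.

"Pressure moments are not dissipated by viscosity" — an explicit-witness no-go; nothing is claimed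
about regularity.
-/

noncomputable section

open MeasureTheory Set Filter Topology Real
open scoped InnerProductSpace ContDiff

namespace Summit.NavierStokesRegularity.FunctionalMining

open Literature.Analysis Literature.Analysis.FunctionSpaces Literature.Analysis.FunctionSpaces.Torus
open Literature.Analysis.FluidPDE

namespace CrossedShear

/-! ## 1. The cell function `cc(x) = cos 2πx₀ cos 2πx₁` -/

/-- `cc(x) = C(x₀) C(x₁)`. [ours; bookkeeping] -/
def cc (x : UnitAddTorus (Fin 3)) : ℝ := cosP.onCircle (x 0) * cosP.onCircle (x 1)

/-- `cc` is smooth. [folklore] -/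
theorem isSmooth_cc : IsSmooth cc := isSmooth_prod₂ cosP cosP 0 1

/-- `∫ cc = 0`. [folklore] -/
theorem integral_cc : ∫ x, cc x = 0 := by
  have h := MeasureTheory.integral_fintype_prod_volume_eq_prod (𝕜 := ℝ)
    (![cosP.onCircle, cosP.onCircle, fun _ => (1 : ℝ)] : Fin 3 → UnitAddCircle → ℝ)
  have e : (fun x : UnitAddTorus (Fin 3) => ∏ i, (![cosP.onCircle, cosP.onCircle, fun _ => (1 : ℝ)] :
      Fin 3 → UnitAddCircle → ℝ) i (x i)) = cc := by
    funext x
    rw [Fin.prod_univ_three]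
    simp [cc]
  rw [e, Fin.prod_univ_three] at h
  rw [h]
  simp [integral_circle_cosP]

/-- `∫ h(x₂) C(x₀)² C(x₁)² = (∫h)/4` for continuous `h`. [folklore] -/
theorem integral_mul_cc_sq {h : UnitAddCircle → ℝ} :
    ∫ x : UnitAddTorus (Fin 3), h (x 2) * cc x ^ 2 = (∫ b, h b) / 4 := by
  have hf := MeasureTheory.integral_fintype_prod_volume_eq_prod (𝕜 := ℝ)
    (![fun b => cosP.onCircle b ^ 2, fun b => cosP.onCircle b ^ 2, h] : Fin 3 → UnitAddCircle → ℝ)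
  have e : (fun x : UnitAddTorus (Fin 3) => ∏ i, (![fun b => cosP.onCircle b ^ 2, fun b => cosP.onCircle b ^ 2, h] :
      Fin 3 → UnitAddCircle → ℝ) i (x i)) = fun x => h (x 2) * cc x ^ 2 := by
    funext x
    rw [Fin.prod_univ_three]
    simp [cc]
    ring
  rw [e, Fin.prod_univ_three] at hf
  rw [hf]
  simp [integral_circle_cosP_sq]
  ring

/-- `Δ cc = −8π² cc`. [folklore] -/
theorem laplacian_cc (x : UnitAddTorus (Fin 3)) : Torus.laplacian cc x = -(8 * π ^ 2) * cc x := by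
  have h0 : Torus.partialDeriv 0 cc = fun y : UnitAddTorus (Fin 3) => -(2 * π) * (sinP.onCircle (y 0) * cosP.onCircle (y 1)) := by
    funext y
    show Torus.partialDeriv 0 (fun y : UnitAddTorus (Fin 3) => cosP.onCircle (y 0) * cosP.onCircle (y 1)) y = _
    rw [partialDeriv_prod₂]; simp [cosP_D_onCircle]; ring
  have h1 : Torus.partialDeriv 1 cc = fun y : UnitAddTorus (Fin 3) => -(2 * π) * (cosP.onCircle (y 0) * sinP.onCircle (y 1)) := by
    funext y
    show Torus.partialDeriv 1 (fun y : UnitAddTorus (Fin 3) => cosP.onCircle (y 0) * cosP.onCircle (y 1)) y = _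
    rw [partialDeriv_prod₂]; simp [cosP_D_onCircle]; ring
  have h2 : Torus.partialDeriv 2 cc = fun _ : UnitAddTorus (Fin 3) => (0 : ℝ) := by
    funext y
    show Torus.partialDeriv 2 (fun y : UnitAddTorus (Fin 3) => cosP.onCircle (y 0) * cosP.onCircle (y 1)) y = _
    rw [partialDeriv_prod₂]; simp
  rw [Torus.laplacian_eq_sum_partialDeriv_partialDeriv isSmooth_cc, Fin.sum_univ_three, h0, h1, h2]
  have e0 : Torus.partialDeriv 0 (fun y : UnitAddTorus (Fin 3) => -(2 * π) * (sinP.onCircle (y 0) * cosP.onCircle (y 1))) x =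
      -(2 * π) * (2 * π * cosP.onCircle (x 0) * cosP.onCircle (x 1)) := by
    have hc : IsContDiff 1 (fun y : UnitAddTorus (Fin 3) => sinP.onCircle (y 0) * cosP.onCircle (y 1)) :=
      (isSmooth_prod₂ sinP cosP 0 1).isContDiff (by simp)
    rw [show (fun y : UnitAddTorus (Fin 3) => -(2 * π) * (sinP.onCircle (y 0) * cosP.onCircle (y 1))) =
      (-(2 * π)) • (fun y : UnitAddTorus (Fin 3) => sinP.onCircle (y 0) * cosP.onCircle (y 1)) from by funext y; simp [smul_eq_mul],
      Torus.partialDeriv_const_smul hc, Pi.smul_apply, smul_eq_mul, partialDeriv_prod₂]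
    simp [sinP_D_onCircle]
  have e1 : Torus.partialDeriv 1 (fun y : UnitAddTorus (Fin 3) => -(2 * π) * (cosP.onCircle (y 0) * sinP.onCircle (y 1))) x =
      -(2 * π) * (cosP.onCircle (x 0) * (2 * π * cosP.onCircle (x 1))) := by
    have hc : IsContDiff 1 (fun y : UnitAddTorus (Fin 3) => cosP.onCircle (y 0) * sinP.onCircle (y 1)) :=
      (isSmooth_prod₂ cosP sinP 0 1).isContDiff (by simp)
    rw [show (fun y : UnitAddTorus (Fin 3) => -(2 * π) * (cosP.onCircle (y 0) * sinP.onCircle (y 1))) =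
      (-(2 * π)) • (fun y : UnitAddTorus (Fin 3) => cosP.onCircle (y 0) * sinP.onCircle (y 1)) from by funext y; simp [smul_eq_mul],
      Torus.partialDeriv_const_smul hc, Pi.smul_apply, smul_eq_mul, partialDeriv_prod₂]
    simp [sinP_D_onCircle]
  have e2 : Torus.partialDeriv 2 (fun _ : UnitAddTorus (Fin 3) => (0 : ℝ)) x = 0 := by
    simp [Torus.partialDeriv, Torus.lineDeriv]
  rw [e0, e1, e2, cc]
  ring

/-- **`Δ⁻¹ cc = −cc/(8π²)`.** [folklore] -/
theorem invLaplacian_cc : Torus.invLaplacian cc = fun x => -(1 / (8 * π ^ 2)) * cc x := by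
  have hg : IsSmooth (fun x => -(1 / (8 * π ^ 2)) * cc x) := by
    have h := IsSmooth.smul (-(1 / (8 * π ^ 2))) isSmooth_cc
    have e : ((-(1 / (8 * π ^ 2))) • cc) = fun x => -(1 / (8 * π ^ 2)) * cc x := by
      funext y; simp [smul_eq_mul]
    rw [e] at h
    exact h
  have hπ : (π : ℝ) ≠ 0 := Real.pi_ne_zero
  have hΔ : cc = Torus.laplacian (fun x => -(1 / (8 * π ^ 2)) * cc x) := by
    funext x
    have e : (fun x => -(1 / (8 * π ^ 2)) * cc x) = (-(1 / (8 * π ^ 2))) • cc := by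
      funext y; simp [smul_eq_mul]
    rw [e, Torus.laplacian_const_smul_apply isSmooth_cc, smul_eq_mul, laplacian_cc]
    field_simp
  have h0 : ∫ x, -(1 / (8 * π ^ 2)) * cc x = 0 := by
    rw [integral_const_mul, integral_cc, mul_zero]
  conv_lhs => rw [hΔ]
  exact Torus.invLaplacian_laplacian_of_integral_eq_zero hg h0

/-! ## 2. The pressure of the crossed shear -/

variable (β : ℝ)

/-- The reciprocal crossed shear `u_β := csField E_β E_{−β}`. [ours; packaging] -/
def cshear (β : ℝ) : UnitAddTorus (Fin 3) → EuclideanSpace ℝ (Fin 3) := csField (expP β) (expP (-β))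

/-- The crossed shear is smooth. [folklore] -/
theorem isSmooth_cshear : IsSmooth (cshear β) := isSmooth_csField _ _
/-- The crossed shear is divergence free. [folklore] -/
theorem isDivFree_cshear : IsDivFree (cshear β) := isDivFree_csField _ _
/-- The crossed shear has zero mean. [folklore] -/
theorem hasZeroMean_cshear : HasZeroMean (cshear β) := hasZeroMean_csField _ _

/-- `E_β E_{−β} = 1` on the circle. [folklore] -/
theorem expP_onCircle_mul (b : UnitAddCircle) : (expP β).onCircle b * (expP (-β)).onCircle b = 1 := by
  obtain ⟨t, rfl⟩ := QuotientAddGroup.mk_surjective b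
  simp only [ShearProfile.onCircle_coe]
  exact expP_mul_expP_neg β t

/-- **`s_{u_β} = ∑ᵢⱼ∂ᵢuⱼ∂ⱼuᵢ = 8π² cc`.** [ours; elementary] -/
theorem gradSqTrace_cshear (x : UnitAddTorus (Fin 3)) : gradSqTrace (cshear β) x = 8 * π ^ 2 * cc x := by
  unfold gradSqTrace cshear
  rw [crossTrace_csField, expP_onCircle_mul, mul_comm ((expP (-β)).onCircle (x 2)), expP_onCircle_mul, cc]
  ring

/-- **The zero-mean pressure of the crossed shear is `cos 2πx₀ cos 2πx₁`.** [ours; elementary] -/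
theorem pressureOf_cshear : pressureOf (cshear β) = cc := by
  have hΔ : (fun x => -gradSqTrace (cshear β) x) = Torus.laplacian cc := by
    funext x; rw [gradSqTrace_cshear, laplacian_cc]; ring
  rw [pressureOf, hΔ]
  exact Torus.invLaplacian_laplacian_of_integral_eq_zero isSmooth_cc integral_cc

/-! ## 3. The viscous rate of `∫π²` at the crossed shear -/

/-- The heat-variation profile in terms of `lapProfile`: `(A″−4π²A)B + (B″−4π²B)A = h_β`. [ours] -/
theorem lapProfile_cross_eq_heatProfile (b : UnitAddCircle) :
    (lapProfile (expP β)).onCircle b * (expP (-β)).onCircle b +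
      (lapProfile (expP (-β))).onCircle b * (expP β).onCircle b = heatProfile β b := by
  rw [lapProfile_onCircle, lapProfile_onCircle, heatProfile]
  ring

/-- **The viscous source of `∫π²` at the crossed shear**: `A_{u_β}(x) = −8π² h_β(x₂) cc(x)`. [ours] -/
theorem pressureSqViscousSource_cshear (x : UnitAddTorus (Fin 3)) :
    pressureSqViscousSource (cshear β) x = -(8 * π ^ 2) * (heatProfile β (x 2) * cc x) := by
  unfold pressureSqViscousSource
  rw [cshear, laplacian_csField, crossTrace_csField, lapProfile_cross_eq_heatProfile, cc]
  ring

/-- **`V₂(u_β) = 2π²(β² − 2)`**: the heat-flow rate of `∫π²` at the reciprocal crossed shear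
(SIEVELD §2, Proposition/Corollary W11 at `q = 2` on the unit torus). [ours] -/
theorem pressureSqViscousRate_cshear : pressureSqViscousRate (cshear β) = 2 * π ^ 2 * (β ^ 2 - 2) := by
  have hsrc : IsSmooth (pressureSqViscousSource (cshear β)) :=
    isSmooth_pressureSqViscousSource (isSmooth_cshear β)
  have hπ : (π : ℝ) ≠ 0 := Real.pi_ne_zero
  unfold pressureSqViscousRate
  rw [pressureOf_cshear]
  -- self-adjointness of `Δ⁻¹`
  have e1 : ∫ x, 2 * cc x * Torus.invLaplacian (pressureSqViscousSource (cshear β)) x =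
      2 * ∫ x, Torus.invLaplacian cc x * pressureSqViscousSource (cshear β) x := by
    rw [Torus.integral_invLaplacian_mul_comm isSmooth_cc hsrc, ← integral_const_mul]
    exact integral_congr_ae (ae_of_all _ fun x => by ring)
  rw [e1, invLaplacian_cc]
  simp only [pressureSqViscousSource_cshear]
  have e2 : ∀ x : UnitAddTorus (Fin 3), -(1 / (8 * π ^ 2)) * cc x * (-(8 * π ^ 2) * (heatProfile β (x 2) * cc x)) =
      heatProfile β (x 2) * cc x ^ 2 := by
    intro x; field_simp
  simp_rw [e2]
  rw [integral_mul_cc_sq, integral_circle_heatProfile]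
  ring

/-! ## 4. The no-go -/

/-- **Kernel no-go (SIEVELD §1–§2, Theorem H + W11): `∫p²` obeys NO saturating law.** For every
`κ`, every `σ` and every `γ ≥ 0`, `SaturatingLaw (torusPressureMoment 2) σ γ κ` fails on `T³`: at the
reciprocal crossed shear `u₂ = (e^{2cos 2πz} sin 2πy, e^{−2cos 2πz} sin 2πx, 0)` (smooth, divergence
free, zero mean) the zero-mean pressure moment `∫π²` has viscous initial rate `V₂ = 4π² > 0`
(it grows under pure diffusion), which the heat sieve forbids. In particular the K0 row
`EP.p.q=2|T_LD|G1` (`σ = 1`, `γ = 5`) is FALSE for every κ. Search for candidate a priori estimates;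
no regularity claim — an explicit-witness no-go. [ours; SIEVELD §1 Thm H, §2 Cor. W11] -/
theorem not_saturatingLaw_pressureMoment_two {σ γ : ℝ} (hγ : 0 ≤ γ) (κ : ℝ) :
    ¬ SaturatingLaw (d := Fin 3) (torusPressureMoment 2) σ γ κ := by
  have hV : 0 < pressureSqViscousRate (cshear 2) := by
    rw [pressureSqViscousRate_cshear]
    have : (0 : ℝ) < π ^ 2 := by positivity
    nlinarith
  exact not_saturatingLaw_of_viscousRate_pos hasInitialRate_torusPressureMoment_two (by simp)
    (isSmooth_cshear 2) (isDivFree_cshear 2) (hasZeroMean_cshear 2) hV hγ κ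

/-- **Row `EP.p.q=2|T_LD|G1` (K0: `σ_F = 1`, `γ_F = 5`) is FALSE for every κ.** [ours] -/
theorem not_saturatingLaw_pressureMoment_two_row (κ : ℝ) :
    ¬ SaturatingLaw (d := Fin 3) (torusPressureMoment 2) 1 5 κ :=
  not_saturatingLaw_pressureMoment_two (by norm_num) κ

end CrossedShear

end Summit.NavierStokesRegularity.FunctionalMining
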